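import Literature.AlgebraicGeometry.HodgeTheory.UnitaryCommutatorsIdentityComponent
import Literature.AlgebraicGeometry.HodgeTheory.StabilizerRestrictionHom
import Literature.AlgebraicGeometry.HodgeTheory.HermitianFormEigenspaceNondegenerate
import Literature.AlgebraicGeometry.HodgeTheory.CyclicReflectionNormalizedRoot
import Literature.AlgebraicGeometry.HodgeTheory.CyclicReflectionEigenspaceSpan
import Literature.AlgebraicGeometry.HodgeTheory.ComplexReflectionTwist
import Literature.AlgebraicGeometry.HodgeTheory.ComplexReflectionRootScaling
import Literature.AlgebraicGeometry.HodgeTheory.CyclicReflectionRational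
import Literature.AlgebraicGeometry.HodgeTheory.GlZariskiClosurePolynomialMap
import Literature.AlgebraicGeometry.HodgeTheory.ZariskiClosureBaseChange
import HarnessLib
/-!
# Crux K1 `VeryGeneralDeckCommutatorsInHg` (stmt-HodgeConjecture-19544), lane D glue, part 1: Goursat–Kolchin–Ribet
# on the half system of eigenblocks — `⊕ SL(E_i)` lies in the identity component of the block image of `Γ ⊗ ℂ`

Helper for `CyclicUnitaryPowersLaneDGlue` (the 400-line limit splits the glue in two): under the hypotheses of the
route's `VeryGeneralDeckCommutatorsInMon` data `(V, B, τ, p, R, Γ)` and the facts CT71, GKR', UD, with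
`E_i = H(ζ^{i+1})`, `i < k = (p−1)/2`, all of dimension `≥ 2`: every `⊕ u_i`, `u_i ∈ SL(E_i)`, lies in
`glIdentityComponent` of the image of `Γ ⊗ ℂ` in `GL(⊕ E_i)`.  Per place the Carlson–Toledo data (orbit of a
normalised root, `ρ_i(r ⊗ ℂ)` = complex `ζ^{i+1}`-reflections, transitivity, spanning, closure equality) feed
`commutator_mem_glZariskiClosure_of_prime_order` (CT 7.1); the twist dichotomies (`ComplexReflectionTwist`) exclude
Katz's couplings (3), (4).  Proof text: prover seat `hodge-nonav-prover-Ax` (g0), skeleton `LaneDGlueSkeleton-v9`;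
packaged by `hodge-nonav-prover-A` (g2). Refs: [CarlsonToledo1999] §§2, 5–7 (Thm 7.1); [Katz1990ESDE] §1.8 Prop. 1.8.2.
-/

noncomputable section

open Module Literature.AlgebraicGeometry.Motives Literature.AlgebraicGeometry.HodgeTheory
open scoped TensorProduct ComplexConjugate

-- mandated namespace `Summit.HodgeConjecture.HodgeConjecture.Theorems` trips `linter.dupNamespace` (off tree-wide)
set_option linter.dupNamespace false

namespace Summit.HodgeConjecture.HodgeConjecture.Theorems.CyclicUnitaryPowersLaneDKatz

/-- **`⊕_i SL(E_i) ⊆ ((image of Γ ⊗ ℂ in GL(⊕ E_i))^Zar)°`** for the half system `E_i = H(ζ^{i+1})`, `i < (p−1)/2`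
(all of dimension `≥ 2`), from CT71 (per place), GKR' and UD: Katz's hypotheses (1′) per place via the
Carlson–Toledo reflection data and (3), (4) via the twist dichotomies. [cite: CarlsonToledo1999, §7 Theorem 7.1 (p. 16)]
[cite: Katz1990ESDE, §1.8 Prop. 1.8.2] -/
theorem blockDiag_mem_glIdentityComponent
    (hCT : carlsonToledo1999_unitaryReflection_zariskiDense) (hK : Katz1990_goursatKolchinRibet_specialLinear')
    (hU : specialLinear_subset_glIdentityComponent_of_unitary_commutators)
    (V : Type) [AddCommGroup V] [Module ℚ V] [Module.Finite ℚ V] (B : LinearMap.BilinForm ℚ V) (τ : V ≃ₗ[ℚ] V)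
    (p : ℕ) (R : Set V) (Γ : Subgroup (V ≃ₗ[ℚ] V)) (hp : p.Prime) (h7 : 7 ≤ p) (hBs : B.IsSymm)
    (hBn : B.Nondegenerate) (hτp : τ ^ p = 1) (hτB : ∀ x y, B (τ x) (τ y) = B x y)
    (hP1 : ∀ δ ∈ R, δ ≠ 0 ∧ (∑ i ∈ Finset.range p, (τ ^ i) δ) = 0 ∧
      ∀ x ∈ Submodule.span ℚ (Set.range fun i : ℕ => (τ ^ i) δ),
        (∀ y ∈ Submodule.span ℚ (Set.range fun i : ℕ => (τ ^ i) δ), B x y = 0) → x = 0)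
    (hP2 : ∀ δ ∈ R, ∃ r ∈ Γ, ((∀ x ∈ Submodule.span ℚ (Set.range fun i : ℕ => (τ ^ i) δ), r x = τ x) ∧
      (∀ x, (∀ y ∈ Submodule.span ℚ (Set.range fun i : ℕ => (τ ^ i) δ), B x y = 0) → r x = x)))
    (hP3 : Γ ≤ Subgroup.closure {r : V ≃ₗ[ℚ] V | ∃ δ ∈ R,
      ((∀ x ∈ Submodule.span ℚ (Set.range fun i : ℕ => (τ ^ i) δ), r x = τ x) ∧
      (∀ x, (∀ y ∈ Submodule.span ℚ (Set.range fun i : ℕ => (τ ^ i) δ), B x y = 0) → r x = x))})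
    (hP4 : ∀ δ ∈ R, ∀ δ' ∈ R, ∃ γ ∈ Γ, γ δ' ∈ Submodule.span ℚ (Set.range fun i : ℕ => (τ ^ i) δ))
    (hP5 : ∀ x, (∑ i ∈ Finset.range p, (τ ^ i) x) = 0 → x ∈ Submodule.span ℚ {y | ∃ δ ∈ R, ∃ i : ℕ, y = (τ ^ i) δ})
    (hΓτB : ∀ γ ∈ Γ, (∀ x, γ (τ x) = τ (γ x)) ∧ ∀ x y, B (γ x) (γ y) = B x y)
    {ζ : ℂ} (hζ : IsPrimitiveRoot ζ p) (k : ℕ) (hk : k = (p - 1) / 2) :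
    let E : Fin k → Submodule ℂ (ℂ ⊗[ℚ] V) :=
      fun i => Module.End.eigenspace ((τ : V →ₗ[ℚ] V).baseChange ℂ) (ζ ^ ((i : ℕ) + 1))
    ∀ (hstabE : ∀ i, Γ.map (glBaseChangeHom ℚ ℂ V) ≤ submoduleStabilizer (E i)),
      (∀ i : Fin k, 2 ≤ finrank ℂ (E i)) → ∀ u : Π i, (E i ≃ₗ[ℂ] E i), (∀ i, LinearEquiv.det (u i) = 1) →
        blockDiagHom (fun i => ↥(E i)) u ∈ glIdentityComponent
          (((⊤ : Subgroup (Γ.map (glBaseChangeHom ℚ ℂ V))).map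
            (piRestrictHom E (Γ.map (glBaseChangeHom ℚ ℂ V)) hstabE)).map (blockDiagHom fun i => ↥(E i))) := by
  intro E hstabE hdim
  have hp0 : 0 < p := hp.pos
  have hpow : ∀ n : ℕ, ((τ : V →ₗ[ℚ] V)) ^ n = ((τ ^ n : V ≃ₗ[ℚ] V) : V →ₗ[ℚ] V) := by
    intro n
    induction n with
    | zero => rw [pow_zero, pow_zero, LinearEquiv.coe_toLinearMap_one]; rfl
    | succ n ih => rw [pow_succ, pow_succ, LinearEquiv.coe_toLinearMap_mul, ih]
  have hτp' : ((τ : V →ₗ[ℚ] V)) ^ p = 1 := by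
    rw [hpow, hτp, LinearEquiv.coe_toLinearMap_one]; rfl
  have hpowapp : ∀ (i : ℕ) (x : V), (((τ : V →ₗ[ℚ] V)) ^ i) x = (τ ^ i) x := fun i x => by
    rw [hpow]; rfl
  set Γc : Subgroup (ℂ ⊗[ℚ] V ≃ₗ[ℂ] ℂ ⊗[ℚ] V) := Γ.map (glBaseChangeHom ℚ ℂ V) with hΓc
  let ρ : Γc →* Π i, (E i ≃ₗ[ℂ] E i) := piRestrictHom E Γc hstabE
  set H : Subgroup (Π i, (E i ≃ₗ[ℂ] E i)) := (⊤ : Subgroup Γc).map ρ with hH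
  have hP1' : ∀ δ ∈ R, δ ≠ 0 ∧ (∑ i ∈ Finset.range p, (((τ : V →ₗ[ℚ] V)) ^ i) δ) = 0 ∧
      ∀ x ∈ Submodule.span ℚ (Set.range fun i : ℕ => (((τ : V →ₗ[ℚ] V)) ^ i) δ),
        (∀ y ∈ Submodule.span ℚ (Set.range fun i : ℕ => (((τ : V →ₗ[ℚ] V)) ^ i) δ), B x y = 0) → x = 0 := by
    intro δ hδ
    simpa only [hpowapp] using hP1 δ hδ
  have hP5' : ∀ x : V, ∑ i ∈ Finset.range p, (((τ : V →ₗ[ℚ] V)) ^ i) x = 0 →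
      x ∈ Submodule.span ℚ {y | ∃ δ ∈ R, ∃ i : ℕ, y = (((τ : V →ₗ[ℚ] V)) ^ i) δ} := by
    simpa only [hpowapp] using hP5
  have hik : ∀ i : Fin k, 1 ≤ (i : ℕ) + 1 ∧ (i : ℕ) + 1 < p := fun i => ⟨by omega, by have := i.2; omega⟩
  have hζ0 : ζ ≠ 0 := hζ.ne_zero hp0.ne'
  have hl : ∀ i : Fin k, ζ ^ ((i : ℕ) + 1) ≠ 1 ∧ ζ ^ ((i : ℕ) + 1) ≠ 0 := by
    intro i
    refine ⟨fun h1 => ?_, pow_ne_zero _ hζ0⟩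
    have hdvd := (hζ.pow_eq_one_iff_dvd _).1 h1
    have := Nat.le_of_dvd (by omega) hdvd
    have := (hik i).2
    omega
  have hRne : R.Nonempty := by
    by_contra hR
    rw [Set.not_nonempty_iff_eq_empty] at hR
    let i0 : Fin k := ⟨0, by omega⟩
    have hspan := span_eigencomponent_eq_eigenspace (R := R) (ζ := ζ) hτp' hζ hp0 hP5' (hik i0).1 (hik i0).2
    have hbot : Module.End.eigenspace ((τ : V →ₗ[ℚ] V).baseChange ℂ) (ζ ^ ((i0 : ℕ) + 1)) = ⊥ := by
      rw [← hspan, Submodule.span_eq_bot]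
      rintro _ ⟨δ, hδ, _⟩
      rw [hR] at hδ
      exact absurd hδ (Set.notMem_empty δ)
    have h2 := hdim i0
    change 2 ≤ finrank ℂ (Module.End.eigenspace ((τ : V →ₗ[ℚ] V).baseChange ℂ) (ζ ^ ((i0 : ℕ) + 1))) at h2
    rw [hbot, finrank_bot] at h2
    omega
  -- the i-th block of a generator is the complex ζ^(i+1)-reflection of (E_i, h|E_i) along δ̂  [part 8]
  have hrefl : ∀ (i : Fin k) (δ : V) (hδ : δ ∈ R) (r : V ≃ₗ[ℚ] V)
      (hr1 : ∀ x ∈ Submodule.span ℚ (Set.range fun n : ℕ => (τ ^ n) δ), r x = τ x)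
      (hr2 : ∀ x, (∀ y ∈ Submodule.span ℚ (Set.range fun n : ℕ => (τ ^ n) δ), B x y = 0) → r x = x)
      (hrΓ : r ∈ Γ),
      ((ρ ⟨glBaseChangeHom ℚ ℂ V r, Subgroup.mem_map_of_mem _ hrΓ⟩ i : E i ≃ₗ[ℂ] E i) : E i →ₗ[ℂ] E i) =
        complexReflection ((hermitianOfBilin B).domRestrict₁₂ (E i) (E i))
          (hermitianSign B (eigencomponent (τ : V →ₗ[ℚ] V) p ζ ((i : ℕ) + 1) δ)) (ζ ^ ((i : ℕ) + 1))
          ⟨normalizeRoot B (eigencomponent (τ : V →ₗ[ℚ] V) p ζ ((i : ℕ) + 1) δ),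
            normalizeRoot_mem (eigencomponent_mem_eigenspace hτp' hζ.pow_eq_one hζ0 _ δ)⟩ := by
    intro i δ hδ r hr1 hr2 hrΓ
    have hr1' : ∀ x ∈ Submodule.span ℚ (Set.range fun n : ℕ => (((τ : V →ₗ[ℚ] V)) ^ n) δ),
        r x = (τ : V →ₗ[ℚ] V) x := by
      simpa only [hpowapp, LinearEquiv.coe_coe] using hr1
    have hr2' : ∀ x, (∀ y ∈ Submodule.span ℚ (Set.range fun n : ℕ => (((τ : V →ₗ[ℚ] V)) ^ n) δ), B x y = 0) →
        r x = x := by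
      simpa only [hpowapp] using hr2
    exact restrictLinearEquiv_baseChange_reflection_eq_complexReflection hp hτp' hζ hBs hτB (hP1' δ hδ).1
      (hP1' δ hδ).2.1 (hP1' δ hδ).2.2 hr1' hr2' (hik i).1 (hik i).2 (hstabE i (Subgroup.mem_map_of_mem _ hrΓ))
  have hsign : ∀ (i : Fin k) (δ : V), δ ∈ R →
      hermitianSign B (eigencomponent (τ : V →ₗ[ℚ] V) p ζ ((i : ℕ) + 1) δ) *
          hermitianSign B (eigencomponent (τ : V →ₗ[ℚ] V) p ζ ((i : ℕ) + 1) δ) = 1 ∧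
        ((hermitianOfBilin B).domRestrict₁₂ (E i) (E i))
          ⟨normalizeRoot B (eigencomponent (τ : V →ₗ[ℚ] V) p ζ ((i : ℕ) + 1) δ),
            normalizeRoot_mem (eigencomponent_mem_eigenspace hτp' hζ.pow_eq_one hζ0 _ δ)⟩
          ⟨normalizeRoot B (eigencomponent (τ : V →ₗ[ℚ] V) p ζ ((i : ℕ) + 1) δ),
            normalizeRoot_mem (eigencomponent_mem_eigenspace hτp' hζ.pow_eq_one hζ0 _ δ)⟩ =
          hermitianSign B (eigencomponent (τ : V →ₗ[ℚ] V) p ζ ((i : ℕ) + 1) δ) := by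
    intro i δ hδ
    have hne := hermitianOfBilin_eigencomponent_self_ne_zero hp hτp' hζ hBs hτB (hP1' δ hδ).1 (hP1' δ hδ).2.1
      (hP1' δ hδ).2.2 (hik i).1 (hik i).2
    exact ⟨hermitianSign_mul_self hBs hne, by
      rw [LinearMap.domRestrict₁₂_apply]; exact hermitianOfBilin_normalizeRoot_self hBs hne⟩
  -- the generators lie in Γ (clause P2 + uniqueness of the cyclic reflection), so `closure (bc S) ≤ Γ ⊗ ℂ`
  have hSΓ : {r : V ≃ₗ[ℚ] V | ∃ δ ∈ R, ((∀ x ∈ Submodule.span ℚ (Set.range fun i : ℕ => (τ ^ i) δ), r x = τ x) ∧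
      (∀ x, (∀ y ∈ Submodule.span ℚ (Set.range fun i : ℕ => (τ ^ i) δ), B x y = 0) → r x = x))} ⊆ (Γ : Set (V ≃ₗ[ℚ] V)) := by
    rintro r' ⟨δ, hδ, hr'1, hr'2⟩
    obtain ⟨r, hrΓ, hr1, hr2⟩ := hP2 δ hδ
    have htr : ∀ (f : V ≃ₗ[ℚ] V), (∀ x ∈ Submodule.span ℚ (Set.range fun i : ℕ => (τ ^ i) δ), f x = τ x) →
        ∀ x ∈ Submodule.span ℚ (Set.range fun n : ℕ => (((τ : V →ₗ[ℚ] V)) ^ n) δ), (f : V →ₗ[ℚ] V) x = (τ : V →ₗ[ℚ] V) x := by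
      intro f hf
      simpa only [hpowapp, LinearEquiv.coe_coe] using hf
    have htr2 : ∀ (f : V ≃ₗ[ℚ] V), (∀ x, (∀ y ∈ Submodule.span ℚ (Set.range fun i : ℕ => (τ ^ i) δ), B x y = 0) → f x = x) →
        ∀ x, (∀ y ∈ Submodule.span ℚ (Set.range fun n : ℕ => (((τ : V →ₗ[ℚ] V)) ^ n) δ), B x y = 0) → (f : V →ₗ[ℚ] V) x = x := by
      intro f hf
      simpa only [hpowapp, LinearEquiv.coe_coe] using hf
    have heq : (r : V →ₗ[ℚ] V) = (r' : V →ₗ[ℚ] V) :=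
      cyclicReflection_unique hBs (hP1' δ hδ).2.2 (htr r hr1) (htr2 r hr2) (htr r' hr'1) (htr2 r' hr'2)
    have : r' = r := (LinearEquiv.toLinearMap_injective heq).symm
    rw [this]
    exact hrΓ
  have hclΓc : Subgroup.closure (glBaseChangeHom ℚ ℂ V '' {r : V ≃ₗ[ℚ] V | ∃ δ ∈ R,
      ((∀ x ∈ Submodule.span ℚ (Set.range fun i : ℕ => (τ ^ i) δ), r x = τ x) ∧
      (∀ x, (∀ y ∈ Submodule.span ℚ (Set.range fun i : ℕ => (τ ^ i) δ), B x y = 0) → r x = x))}) ≤ Γc := by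
    rw [← MonoidHom.map_closure]
    exact Subgroup.map_mono ((Subgroup.closure_le _).2 hSΓ)
  intro u hu
  refine hK.of_unitary_commutators hU ?_ hdim H ?_ ?_ ?_ u hu
  · -- 2 ≤ card (Fin k), k = (p-1)/2 ≥ 3
    simp only [Fintype.card_fin]
    omega
  · -- h1: per place, the restricted hermitian form and Carlson–Toledo density (p534010) [TODO part 8]
    intro i
    refine ⟨(hermitianOfBilin B).domRestrict₁₂ (E i) (E i), isSymm_hermitianOfBilin_domRestrict hBs (E i),
      nondegenerate_hermitianOfBilin_domRestrict_eigenspace hτp' hζ hp0 hBs hBn hτB (by omega), ?_⟩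
    intro u₁ u₂ hu₁ hu₂
    -- S3: the data of Carlson–Toledo's density theorem at the place `i`
    obtain ⟨δ₀, hδ₀⟩ := hRne
    obtain ⟨r₀, hr₀Γ, hr₀1, hr₀2⟩ := hP2 δ₀ hδ₀
    obtain ⟨hε2, hunit⟩ := hsign i δ₀ hδ₀
    have hne₀ := hermitianOfBilin_eigencomponent_self_ne_zero hp hτp' hζ hBs hτB (hP1' δ₀ hδ₀).1 (hP1' δ₀ hδ₀).2.1
      (hP1' δ₀ hδ₀).2.2 (hik i).1 (hik i).2
    have hε := hermitianSign_eq_one_or hBs hne₀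
    -- the unit root `d̂` and its orbit `Δ` under `Γ_i = ρ_i(Γ ⊗ ℂ)`
    let dhat : E i := ⟨normalizeRoot B (eigencomponent (τ : V →ₗ[ℚ] V) p ζ ((i : ℕ) + 1) δ₀),
      normalizeRoot_mem (eigencomponent_mem_eigenspace hτp' hζ.pow_eq_one hζ0 _ δ₀)⟩
    let ρi : Γc →* (E i ≃ₗ[ℂ] E i) := restrictEquivHom (E i) Γc (hstabE i)
    have hΓi : H.map (Pi.evalMonoidHom (fun i => E i ≃ₗ[ℂ] E i) i) = (⊤ : Subgroup Γc).map ρi :=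
      map_piRestrictHom_map_eval E Γc hstabE ⊤ i
    let Δ : Set (E i) := {x | ∃ θ : Γc, x = ρi θ dhat}
    have hΔ : ∀ x ∈ Δ, (hermitianOfBilin B).domRestrict₁₂ (E i) (E i) x x =
        hermitianSign B (eigencomponent (τ : V →ₗ[ℚ] V) p ζ ((i : ℕ) + 1) δ₀) := by
      rintro _ ⟨θ, rfl⟩
      rw [restrictEquivHom_unitary (fun γ hγ => (hΓτB γ hγ).1) (fun γ hγ => (hΓτB γ hγ).2)]
      exact hunit
    have hstab : ∀ g ∈ H.map (Pi.evalMonoidHom (fun i => E i ≃ₗ[ℂ] E i) i), ∀ x ∈ Δ, g x ∈ Δ := by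
      rw [hΓi]
      rintro _ ⟨θ, -, rfl⟩ _ ⟨θ', rfl⟩
      exact ⟨θ * θ', by rw [map_mul, LinearEquiv.mul_apply]⟩
    have htrans : ∀ x ∈ Δ, ∀ x' ∈ Δ, ∃ g ∈ H.map (Pi.evalMonoidHom (fun i => E i ≃ₗ[ℂ] E i) i), g x = x' := by
      rw [hΓi]
      rintro _ ⟨θ, rfl⟩ _ ⟨θ', rfl⟩
      refine ⟨ρi (θ' * θ⁻¹), ⟨θ' * θ⁻¹, Subgroup.mem_top _, rfl⟩, ?_⟩
      rw [map_mul, map_inv, LinearEquiv.mul_apply]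
      show ρi θ' ((ρi θ).symm (ρi θ dhat)) = _
      rw [LinearEquiv.symm_apply_apply]
    -- every `δ ∈ R` contributes a NON-ZERO multiple of its eigencomponent to the orbit `Δ` (clause P4, part 7)
    have hmult : ∀ δ ∈ R, ∃ θ : Γc, ∃ c : ℂ, c ≠ 0 ∧
        ((ρi θ dhat : E i) : ℂ ⊗[ℚ] V) = c • eigencomponent (τ : V →ₗ[ℚ] V) p ζ ((i : ℕ) + 1) δ := by
      intro δ hδR
      obtain ⟨γ, hγΓ, hγδ⟩ := hP4 δ hδR δ₀ hδ₀
      have hγδ' : (γ : V →ₗ[ℚ] V) δ₀ ∈ Submodule.span ℚ (Set.range fun n : ℕ => (((τ : V →ₗ[ℚ] V)) ^ n) δ) := by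
        simpa only [hpowapp, LinearEquiv.coe_coe] using hγδ
      have hγc : (γ : V →ₗ[ℚ] V) ∘ₗ (τ : V →ₗ[ℚ] V) = (τ : V →ₗ[ℚ] V) ∘ₗ (γ : V →ₗ[ℚ] V) :=
        LinearMap.ext fun x => by simpa using (hΓτB γ hγΓ).1 x
      obtain ⟨c, hc⟩ := exists_baseChange_eigencomponent_eq_smul hγc hτp' hζ hp0 (hik i).2 hγδ'
      have hc0 : c ≠ 0 := by
        intro h0
        rw [h0, zero_smul] at hc
        have hu := hermitianOfBilin_baseChange (g := (γ : V →ₗ[ℚ] V)) (hΓτB γ hγΓ).2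
          (eigencomponent (τ : V →ₗ[ℚ] V) p ζ ((i : ℕ) + 1) δ₀) (eigencomponent (τ : V →ₗ[ℚ] V) p ζ ((i : ℕ) + 1) δ₀)
        rw [hc, map_zero] at hu
        exact hne₀ hu.symm
      set sR : ℝ := (Real.sqrt ‖hermitianOfBilin B (eigencomponent (τ : V →ₗ[ℚ] V) p ζ ((i : ℕ) + 1) δ₀)
        (eigencomponent (τ : V →ₗ[ℚ] V) p ζ ((i : ℕ) + 1) δ₀)‖)⁻¹ with hsR
      have hsR0 : (sR : ℂ) ≠ 0 := by
        have : 0 < sR := inv_pos.2 (Real.sqrt_pos.2 (norm_pos_iff.2 hne₀))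
        exact_mod_cast this.ne'
      refine ⟨⟨glBaseChangeHom ℚ ℂ V γ, Subgroup.mem_map_of_mem _ hγΓ⟩, (sR : ℂ) * c, mul_ne_zero hsR0 hc0, ?_⟩
      change ((glBaseChangeHom ℚ ℂ V γ : ℂ ⊗[ℚ] V ≃ₗ[ℂ] ℂ ⊗[ℚ] V) : ℂ ⊗[ℚ] V →ₗ[ℂ] ℂ ⊗[ℚ] V)
        (normalizeRoot B (eigencomponent (τ : V →ₗ[ℚ] V) p ζ ((i : ℕ) + 1) δ₀)) = _
      rw [coe_glBaseChangeHom, normalizeRoot_def, map_smul, hc, smul_smul]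
    -- S3a: `Δ` spans `E_i` (`E_i = span {δ_(i+1)(δ)}`, part 7, and `hmult`)
    have hspan : Submodule.span ℂ Δ = ⊤ := by
      apply Submodule.map_injective_of_injective (E i).injective_subtype
      rw [Submodule.map_subtype_top, Submodule.map_span]
      refine le_antisymm (Submodule.span_le.2 ?_) ?_
      · rintro _ ⟨x, _, rfl⟩
        exact x.2
      · change Module.End.eigenspace ((τ : V →ₗ[ℚ] V).baseChange ℂ) (ζ ^ ((i : ℕ) + 1)) ≤ _
        rw [← span_eigencomponent_eq_eigenspace (R := R) (ζ := ζ) hτp' hζ hp0 hP5' (hik i).1 (hik i).2]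
        refine Submodule.span_le.2 ?_
        rintro _ ⟨δ, hδR, rfl⟩
        obtain ⟨θ, c, hc0, hval⟩ := hmult δ hδR
        have hmem : ((ρi θ dhat : E i) : ℂ ⊗[ℚ] V) ∈ Submodule.span ℂ ((E i).subtype '' Δ) :=
          Submodule.subset_span ⟨ρi θ dhat, ⟨θ, rfl⟩, rfl⟩
        have heq : eigencomponent (τ : V →ₗ[ℚ] V) p ζ ((i : ℕ) + 1) δ = c⁻¹ • ((ρi θ dhat : E i) : ℂ ⊗[ℚ] V) := by
          rw [hval, smul_smul, inv_mul_cancel₀ hc0, one_smul]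
        rw [heq]
        exact Submodule.smul_mem _ _ hmem
    -- S3b: `Γ_i` IS the group generated by the `ζ^(i+1)`-reflections along `Δ`
    have hunitρ : ∀ θ : Γc, ∀ x y : E i,
        (hermitianOfBilin B).domRestrict₁₂ (E i) (E i) (ρi θ x) (ρi θ y) =
          (hermitianOfBilin B).domRestrict₁₂ (E i) (E i) x y :=
      fun θ x y => restrictEquivHom_unitary (fun γ hγ => (hΓτB γ hγ).1) (fun γ hγ => (hΓτB γ hγ).2) _ θ x y
    have hθ₀ : (((ρi ⟨glBaseChangeHom ℚ ℂ V r₀, Subgroup.mem_map_of_mem _ hr₀Γ⟩ : E i ≃ₗ[ℂ] E i)) : E i →ₗ[ℂ] E i) =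
        complexReflection ((hermitianOfBilin B).domRestrict₁₂ (E i) (E i))
          (hermitianSign B (eigencomponent (τ : V →ₗ[ℚ] V) p ζ ((i : ℕ) + 1) δ₀)) (ζ ^ ((i : ℕ) + 1)) dhat :=
      hrefl i δ₀ hδ₀ r₀ hr₀1 hr₀2 hr₀Γ
    have hΓ : H.map (Pi.evalMonoidHom (fun i => E i ≃ₗ[ℂ] E i) i) =
        Subgroup.closure {g : E i ≃ₗ[ℂ] E i | ∃ x ∈ Δ, (g : E i →ₗ[ℂ] E i) =
          complexReflection ((hermitianOfBilin B).domRestrict₁₂ (E i) (E i))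
            (hermitianSign B (eigencomponent (τ : V →ₗ[ℚ] V) p ζ ((i : ℕ) + 1) δ₀)) (ζ ^ ((i : ℕ) + 1)) x} := by
      rw [hΓi]
      apply le_antisymm
      · -- `ρ_i(Γ ⊗ ℂ)` is generated by the `ρ_i(r ⊗ ℂ)`, `r` a cyclic reflection, each a reflection along `Δ`
        rw [Subgroup.map_le_iff_le_comap]
        intro θ _
        rw [Subgroup.mem_comap]
        have hθcl : (θ : ℂ ⊗[ℚ] V ≃ₗ[ℂ] ℂ ⊗[ℚ] V) ∈ Subgroup.closure (glBaseChangeHom ℚ ℂ V ''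
            {r : V ≃ₗ[ℚ] V | ∃ δ ∈ R, ((∀ x ∈ Submodule.span ℚ (Set.range fun i : ℕ => (τ ^ i) δ), r x = τ x) ∧
              (∀ x, (∀ y ∈ Submodule.span ℚ (Set.range fun i : ℕ => (τ ^ i) δ), B x y = 0) → r x = x))}) := by
          rw [← MonoidHom.map_closure]
          exact Subgroup.map_mono hP3 θ.2
        have key : ∀ y ∈ Subgroup.closure (glBaseChangeHom ℚ ℂ V ''
            {r : V ≃ₗ[ℚ] V | ∃ δ ∈ R, ((∀ x ∈ Submodule.span ℚ (Set.range fun i : ℕ => (τ ^ i) δ), r x = τ x) ∧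
              (∀ x, (∀ y ∈ Submodule.span ℚ (Set.range fun i : ℕ => (τ ^ i) δ), B x y = 0) → r x = x))}),
            ∀ hy : y ∈ Γc, ρi ⟨y, hy⟩ ∈ Subgroup.closure {g : E i ≃ₗ[ℂ] E i | ∃ x ∈ Δ, (g : E i →ₗ[ℂ] E i) =
              complexReflection ((hermitianOfBilin B).domRestrict₁₂ (E i) (E i))
                (hermitianSign B (eigencomponent (τ : V →ₗ[ℚ] V) p ζ ((i : ℕ) + 1) δ₀)) (ζ ^ ((i : ℕ) + 1)) x} := by
          intro y hy
          induction hy using Subgroup.closure_induction with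
          | mem y hyS =>
            intro hyc
            obtain ⟨r, ⟨δ, hδR, hr1, hr2⟩, rfl⟩ := hyS
            have hrΓ : r ∈ Γ := hSΓ ⟨δ, hδR, hr1, hr2⟩
            apply Subgroup.subset_closure
            -- the block is the reflection along `d̂(δ)`, a phase multiple of an element of `Δ`
            have hblock := hrefl i δ hδR r hr1 hr2 hrΓ
            obtain ⟨θ', c, hc0, hval⟩ := hmult δ hδR
            obtain ⟨hεδ2, hunitδ⟩ := hsign i δ hδR
            have hneδ := hermitianOfBilin_eigencomponent_self_ne_zero hp hτp' hζ hBs hτB (hP1' δ hδR).1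
              (hP1' δ hδR).2.1 (hP1' δ hδR).2.2 (hik i).1 (hik i).2
            set sδ : ℝ := (Real.sqrt ‖hermitianOfBilin B (eigencomponent (τ : V →ₗ[ℚ] V) p ζ ((i : ℕ) + 1) δ)
              (eigencomponent (τ : V →ₗ[ℚ] V) p ζ ((i : ℕ) + 1) δ)‖)⁻¹ with hsδ
            set κ : ℂ := (sδ : ℂ) * c⁻¹ with hκ
            have hroot : (⟨normalizeRoot B (eigencomponent (τ : V →ₗ[ℚ] V) p ζ ((i : ℕ) + 1) δ),
                normalizeRoot_mem (eigencomponent_mem_eigenspace hτp' hζ.pow_eq_one hζ0 _ δ)⟩ : E i) =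
                κ • ρi θ' dhat := by
              apply Subtype.ext
              show normalizeRoot B (eigencomponent (τ : V →ₗ[ℚ] V) p ζ ((i : ℕ) + 1) δ) =
                κ • ((ρi θ' dhat : E i) : ℂ ⊗[ℚ] V)
              rw [hval, normalizeRoot_def, smul_smul, hκ, mul_assoc, inv_mul_cancel₀ hc0, mul_one]
            -- signs: `h(κx', κx') = |κ|² h(x', x')` with both values `±1` forces `|κ|² = 1` and equal signs
            have hx' : (hermitianOfBilin B).domRestrict₁₂ (E i) (E i) (ρi θ' dhat) (ρi θ' dhat) =
                hermitianSign B (eigencomponent (τ : V →ₗ[ℚ] V) p ζ ((i : ℕ) + 1) δ₀) := hΔ _ ⟨θ', rfl⟩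
            have hrel : hermitianSign B (eigencomponent (τ : V →ₗ[ℚ] V) p ζ ((i : ℕ) + 1) δ) =
                (starRingEnd ℂ κ * κ) * hermitianSign B (eigencomponent (τ : V →ₗ[ℚ] V) p ζ ((i : ℕ) + 1) δ₀) := by
              rw [← hunitδ, hroot, LinearMap.map_smulₛₗ₂, map_smul, smul_eq_mul, smul_eq_mul, hx']
              ring
            have hκ1 : starRingEnd ℂ κ * κ = 1 := by
              have hnn : starRingEnd ℂ κ * κ = ((Complex.normSq κ : ℝ) : ℂ) := Complex.normSq_eq_conj_mul_self.symm
              rcases hermitianSign_eq_one_or hBs hneδ with h1 | h1 <;>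
                rcases hermitianSign_eq_one_or hBs hne₀ with h2 | h2 <;> rw [h1, h2] at hrel
              · rw [mul_one] at hrel; exact hrel.symm
              · exfalso
                rw [hnn] at hrel
                have h' : ((Complex.normSq κ : ℝ) : ℂ) = -1 := by linear_combination hrel
                have : (Complex.normSq κ : ℝ) = -1 := by exact_mod_cast h'
                linarith [Complex.normSq_nonneg κ]
              · exfalso
                rw [hnn] at hrel
                have h' : ((Complex.normSq κ : ℝ) : ℂ) = -1 := by linear_combination -hrel
                have : (Complex.normSq κ : ℝ) = -1 := by exact_mod_cast h'
                linarith [Complex.normSq_nonneg κ]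
              · rw [mul_neg, mul_one, neg_inj] at hrel; exact hrel.symm
            have hεeq : hermitianSign B (eigencomponent (τ : V →ₗ[ℚ] V) p ζ ((i : ℕ) + 1) δ) =
                hermitianSign B (eigencomponent (τ : V →ₗ[ℚ] V) p ζ ((i : ℕ) + 1) δ₀) := by
              rw [hrel, hκ1, one_mul]
            refine ⟨ρi θ' dhat, ⟨θ', rfl⟩, ?_⟩
            rw [← complexReflection_smul_root _ _ _ hκ1 (ρi θ' dhat), ← hroot, ← hεeq]
            exact hblock
          | one =>
            intro h1
            have : (⟨1, h1⟩ : Γc) = 1 := rfl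
            rw [this, map_one]
            exact Subgroup.one_mem _
          | mul y z hy hz ihy ihz =>
            intro hyz
            have hy' : y ∈ Γc := hclΓc hy
            have hz' : z ∈ Γc := hclΓc hz
            have : (⟨y * z, hyz⟩ : Γc) = ⟨y, hy'⟩ * ⟨z, hz'⟩ := rfl
            rw [this, map_mul]
            exact Subgroup.mul_mem _ (ihy hy') (ihz hz')
          | inv y hy ih =>
            intro hy1
            have hy' : y ∈ Γc := hclΓc hy
            have : (⟨y⁻¹, hy1⟩ : Γc) = ⟨y, hy'⟩⁻¹ := rfl
            rw [this, map_inv]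
            exact Subgroup.inv_mem _ (ih hy')
        exact key _ hθcl θ.2
      · -- each reflection along `x = ρ_i(θ) d̂ ∈ Δ` is `ρ_i(θ r₀ θ⁻¹)`
        rw [Subgroup.closure_le]
        rintro g ⟨x, ⟨θ, rfl⟩, hg⟩
        have hconj := coe_conj_eq_complexReflection ((hermitianOfBilin B).domRestrict₁₂ (E i) (E i)) (u := ρi θ)
          (hunitρ θ) hθ₀
        have hgeq : g = ρi (θ * ⟨glBaseChangeHom ℚ ℂ V r₀, Subgroup.mem_map_of_mem _ hr₀Γ⟩ * θ⁻¹) :=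
          LinearEquiv.toLinearMap_injective (by rw [map_mul, map_mul, map_inv, hconj, hg])
        rw [hgeq]
        exact ⟨_, Subgroup.mem_top _, rfl⟩
    exact commutator_mem_glZariskiClosure_of_prime_order hCT (isSymm_hermitianOfBilin_domRestrict hBs (E i))
      (nondegenerate_hermitianOfBilin_domRestrict_eigenspace hτp' hζ hp0 hBs hBn hτB (hik i).2) (hdim i) hε hp h7
      (by rw [← pow_mul, mul_comm, pow_mul, hζ.pow_eq_one, one_pow]) (hl i).1 hΔ hspan hΓ hstab htrans hu₁ hu₂
  · -- h3: no twist-isomorphism between distinct places  [(e): ComplexReflectionTwist]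
    rintro i j hij ⟨A, χ, hAll⟩
    obtain ⟨δ₀, hδ₀⟩ := hRne
    obtain ⟨r₀, hr₀Γ, hr₀1, hr₀2⟩ := hP2 δ₀ hδ₀
    have h := hAll (ρ ⟨_, Subgroup.mem_map_of_mem _ hr₀Γ⟩) (Subgroup.mem_map_of_mem _ (Subgroup.mem_top _))
    rw [hrefl i δ₀ hδ₀ r₀ hr₀1 hr₀2 hr₀Γ, hrefl j δ₀ hδ₀ r₀ hr₀1 hr₀2 hr₀Γ] at h
    obtain ⟨hεi, huniti⟩ := hsign i δ₀ hδ₀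
    obtain ⟨hεj, hunitj⟩ := hsign j δ₀ hδ₀
    rcases twist_complexReflection_dichotomy (hdim i) _ _ hεi hεj (hl i).1 (hl i).2 (hl j).2 huniti hunitj A h
      with h1 | h2
    · exact hij (Fin.ext (by have := hζ.pow_inj (hik i).2 (hik j).2 h1; omega))
    · rw [← pow_add] at h2
      have hdvd := (hζ.pow_eq_one_iff_dvd _).1 h2
      have := Nat.le_of_dvd (by omega) hdvd
      have := i.2
      have := j.2
      omega
  · -- h4: no twist-isomorphism with a contragredient  [(e): ComplexReflectionTwist]
    rintro i j hij ⟨A, χ, hAll⟩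
    obtain ⟨δ₀, hδ₀⟩ := hRne
    obtain ⟨r₀, hr₀Γ, hr₀1, hr₀2⟩ := hP2 δ₀ hδ₀
    have h := hAll (ρ ⟨_, Subgroup.mem_map_of_mem _ hr₀Γ⟩) (Subgroup.mem_map_of_mem _ (Subgroup.mem_top _))
    rw [hrefl j δ₀ hδ₀ r₀ hr₀1 hr₀2 hr₀Γ] at h
    obtain ⟨hεi, huniti⟩ := hsign i δ₀ hδ₀
    obtain ⟨hεj, hunitj⟩ := hsign j δ₀ hδ₀
    rcases twist_dualMap_symm_complexReflection_dichotomy (hdim i) _ _ hεi hεj (hl i).1 (hl i).2 (hl j).2 huniti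
      hunitj (hrefl i δ₀ hδ₀ r₀ hr₀1 hr₀2 hr₀Γ) A h with h2 | h1
    · rw [← pow_add] at h2
      have hdvd := (hζ.pow_eq_one_iff_dvd _).1 h2
      have := Nat.le_of_dvd (by omega) hdvd
      have := i.2
      have := j.2
      omega
    · exact hij (Fin.ext (by have := hζ.pow_inj (hik i).2 (hik j).2 h1; omega))

end Summit.HodgeConjecture.HodgeConjecture.Theorems.CyclicUnitaryPowersLaneDKatz
end
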